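import Summits.BirchSwinnertonDyer.Rank1Residual.Additive.GordCycLeadingTermTwist
import Literature.NumberTheory.EllipticCurves.Delbourgo2002.PAdicBSDLeadingTerm
import Literature.NumberTheory.EllipticCurves.CongruenceVisibilityLocalFactors
import HarnessLib

/-!
# The (G)-cell at analytic rank `0` with DELBOURGO 2002 in the kernel: the Main Conjecture (G) at
# `T = 0` as EQUALITY / LOWER divisibility (typed), and what each gives — `ord_p #Ш_an = ord_p #Ш + ord_p ℓ`
# (cell `b2b-bsdres`, sub-cell additive-p2, gen 18)

HONEST FRAMING (cell `b2b-bsdres`, run/shared/lean/b2b/bsd-rank1-residual/, verbatim in every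
file): the goal of the cell is to DELETE the COMBINATION-SHAPED residual classes of the
Birch–Swinnerton-Dyer formula for ALL analytic-rank `≤ 1` elliptic curves over `ℚ` — "full BSD
formula for every rank `≤ 1` curve in class `C`" assembled STRICTLY from published theorems — so
that the rank-`≤ 1` remainder becomes exactly the CONSTRUCTION-SHAPED classes, which are TYPED
(missing-input `Prop`s), NOT attempted. This is not "finishing BSD". Sub-cell `additive-p2`
(CLASS-OWNERS row "X3/X4 additive — pot. good ordinary / X3♯(G-ord)"), generation 18: research
route; no claim beyond the stated classes; X3♯(G-ord)/X4♯(G-ord) stay CONSTRUCTION-SHAPED; labels /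
census / located gap UNCHANGED; nothing is booked. Two definitions (typed inputs, nothing asserted)
and theorems; ONE new named fact consumed (`Delbourgo2002.mainTheorem`, landed with this generation).

## What and why

Gen 13 (`GordCycLeadingTerm.lean`) typed the DIVISIBILITY direction of Delbourgo's Main Conjecture
(G) at `T = 0` (`CycLeadingTermAt W p`: SOME `g ∈ char_Λ X(E/ℚ_∞)` has `g(0) = u · L(E,1)/Ω_E`) and
proved that it gives the rank-`0` UPPER half on the whole (G)-cell from Delbourgo 1998 Prop. 4. The
residual map (§I N10) then identified the cell's rank-`0` residue "`Typed.MissingLowerBoundAt`" with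
"the LOWER (Eisenstein) divisibility of Delbourgo's MC at `T = 0`" — in prose only: the kernel had no
EXACT algebraic leading term at an additive prime (Prop. 4 is transcribed as an inequality), so no
theorem turned a lower divisibility of the MC into the lower half of BSD. Delbourgo's SECOND paper
(J. Number Theory 95 (2002), Main Theorem (A)+(B): `X` torsion and the Perrin-Riou–Schneider-shaped
leading term at an additive potentially ordinary prime, ANY rank; primary now held) supplies it; the
named fact `Delbourgo2002.mainTheorem` (Literature, this generation) transcribes it weaker than print,
with the local factor `ℓ_p(E)` kept as an unspecified `ℓ ∣ p²` that is `1` OFF the anomalous rows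
(`Delbourgo2002.ReductionNonAnomalous W p`: the good reduction of `E` over the (G)-field has no
`𝔽_p`-point of order `p`) — see that file's reading note (flag `Del02-ThmB-ellp-anomalous`: the
printed `ℓ_p = p²` on the anomalous (G)-rows over-counts; the proofs give a unit).

* §0 TYPED: `CycCharLeadingTermAt W p` — the MC (G) EQUALITY at `T = 0`: EVERY generator `f` of
  `char_Λ X(E/ℚ_∞)` has `f(0) = u · L(E,1)/Ω_E`, `u ∈ ℤ_p^×` — and `CycLowerLeadingTermAt W p` — the
  LOWER divisibility at `T = 0`: `L(E,1)/Ω_E` divides `f(0)` in `ℤ_p`. Equality ⟹ both directions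
  (`cycLeadingTermAt_of_cycChar`, `cycLowerLeadingTermAt_of_cycChar`).
* §1 CORE (`exists_padicVal_shaAn_of_cycLowerLeadingTerm`): on the (G)-cell (`Addv ∧ TypeGOrd`,
  `E` non-CM, `p ≥ 5`, `r_an = 0`) the lower divisibility and Delbourgo 2002 give
  `#Ш_an(E) = q ∈ ℚ` with **`ord_p q + ord_p c = ord_p #Ш(E) + ord_p ℓ`**, `c ∈ ℤ_p ∖ {0}` the
  cofactor (`f(0) = c · L(E,1)/Ω_E`), `ℓ ∣ p²`, `ℓ = 1` off the anomalous rows.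
* §2–§3 (sequel file `GordCharLeadingTermConsequences.lean`) CONSEQUENCES: (a) lower divisibility + non-anomalous ⟹ `MissingLowerBoundAt W p` — the cell's
  rank-`0` residue IS the lower divisibility of Delbourgo's MC at `T = 0`, as a kernel implication, on
  the non-anomalous rows; (b) MC equality ⟹ `MissingUpperBoundAt W p` (again, now from the 2002 paper)
  and `ord_p #Ш ≤ ord_p #Ш_an ≤ ord_p #Ш + 2` on EVERY row, and `BSD(E,p)` on the non-anomalous rows —
  NO image, Tamagawa, Manin or `#Ш_an` hypothesis, EVERY defect `e ∈ {2,3,4,6}`.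
* §3 CLASS FORMS on X4♯(G-ord) and X3♯(G-ord); and, where gen 12/13 DISCHARGED the upper half
  (X4♯(G-ord) ∩ `I₀*` ∩ {`ρ̄` onto}, `p ≥ 5`: Kato's component reading A124 + transport + Birch + Pal),
  `BSD(E,p) ⇐ CycLowerLeadingTermAt W p` ALONE on the non-anomalous rows
  (`ClassX4Gord.bsdp_rankZero_of_cycLower_of_katoComponent`): N10's "X_D1" in the kernel.

What is NOT claimed: `CycCharLeadingTermAt` / `CycLowerLeadingTermAt` are OPEN (Delbourgo's Main
Conjecture (G), Compositio 113 p. 151; Skinner–Urban's lower divisibility needs trivial family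
character and `p ∤ N`); on the ANOMALOUS rows the exact statements wait on the reading of `ℓ_p(E)`
(both Delbourgo papers) — recorded, not resolved here. Labels UNCHANGED.

References: D. Delbourgo, J. Number Theory 95 (2002) 38–71, Theorem (A), (B) [Delbourgo2002];
D. Delbourgo, Compositio Math. 113 (1998) 123–154, Prop. 4, Main Conjecture p. 151 [Delbourgo1998];
K. Kato, Astérisque 295 (2004) Thm. 17.4 [Kato2004Asterisque]; R. L. Miller, LMS J. Comput. Math. 14
(2011) Def. 1.1 [Miller2011LMS].
-/

noncomputable section

open scoped Classical NumberField

open WeierstrassCurve NumberField Literature.NumberTheory.EllipticCurves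
  Literature.NumberTheory.EllipticCurves.ModularForms
  Literature.NumberTheory.EllipticCurves.Rank1Residual
  Literature.NumberTheory.EllipticCurves.Rank1Residual.Typed
  IsDedekindDomain

namespace Summit.BirchSwinnertonDyer.Rank1Residual.Additive

/-! ### §0 The typed inputs: Delbourgo's Main Conjecture (G) at `T = 0`, equality and lower direction -/

/-- **The Main Conjecture (G) at `T = 0` as an EQUALITY, TYPED.** For the globally minimal `W = E` and
the prime `p`: for the cyclotomic `ℤ_p`-extension `κ` with topological generator `γ` matching the
cyclotomic variable, every Pontryagin-dual datum `D` of `Sel_{p^∞}(E/ℚ_∞)` and EVERY GENERATOR `f` of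
`char_Λ X(E/ℚ_∞)`: `f(0) = u · q` with `u ∈ ℤ_p^×`, `q = L(E,1)/Ω_E ∈ ℚ`. Shape = Delbourgo's Main
Conjecture (G)/(M) (Compositio 113 (1998) p. 151: "`ε(T) G_E(T) = ℓ_p(E) ∫ (1+T)^{x_p} dμ_E`" with
`ℓ_p(E) ∈ ℤ_p^×` on the (G)-cell, reading note of `GordCycLeadingTerm`), BOTH divisibilities,
specialised at `T = 0` with the interpolation `∫ dμ_E ∼ L(E,1)/Ω_E`. OPEN; a predicate on `(W, p)`;
its universal closure is NOT asserted. [cite: Delbourgo1998, Main Conjecture (p. 151) (shape only; nothing asserted)] -/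
def CycCharLeadingTermAt (W : WeierstrassCurve ℚ) (p : ℕ) [Fact p.Prime] : Prop :=
  ∀ (κ : ZpExtension ℚ p) (γ : Field.absoluteGaloisGroup ℚ),
    κ.IsCyclotomic → κ.IsTopGenerator γ → IsCyclotomicVariable p γ →
    ∀ (D : W.SelmerDualData κ γ) (f : IwasawaAlgebra p), D.charIdeal = Ideal.span {f} →
      ∃ u : ℤ_[p]ˣ, ∃ q : ℚ,
        W.entireLFunction 1 = (q : ℂ) * (W.realPeriodRat : ℂ) ∧
        ((PowerSeries.constantCoeff f : ℤ_[p]) : ℚ_[p]) = ((u : ℤ_[p]) : ℚ_[p]) * (q : ℚ_[p])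

/-- **The LOWER (Eisenstein-congruence) divisibility of the Main Conjecture (G) at `T = 0`, TYPED.**
Same setting: for EVERY GENERATOR `f` of `char_Λ X(E/ℚ_∞)`, `L(E,1)/Ω_E = q ∈ ℚ` DIVIDES `f(0)` in
`ℤ_p`: `f(0) = c · q` for some `c ∈ ℤ_p` ("`(L_p^{an}) ⊆ char_Λ X`" at the trivial character). This
is the direction NOT given by Kato's Euler system; the residual map's `X_D1` (§I N10). OPEN; a
predicate on `(W, p)`; nothing asserted. [cite: Delbourgo1998, Main Conjecture (p. 151) (shape only; nothing asserted)] -/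
def CycLowerLeadingTermAt (W : WeierstrassCurve ℚ) (p : ℕ) [Fact p.Prime] : Prop :=
  ∀ (κ : ZpExtension ℚ p) (γ : Field.absoluteGaloisGroup ℚ),
    κ.IsCyclotomic → κ.IsTopGenerator γ → IsCyclotomicVariable p γ →
    ∀ (D : W.SelmerDualData κ γ) (f : IwasawaAlgebra p), D.charIdeal = Ideal.span {f} →
      ∃ q : ℚ, W.entireLFunction 1 = (q : ℂ) * (W.realPeriodRat : ℂ) ∧
        ∃ c : ℤ_[p], ((PowerSeries.constantCoeff f : ℤ_[p]) : ℚ_[p]) = (c : ℚ_[p]) * (q : ℚ_[p])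

variable {W : WeierstrassCurve ℚ} {p : ℕ} [hp : Fact p.Prime]

omit hp in
/-- MC equality at `T = 0` gives the UPPER divisibility in gen 13's typed form `CycLeadingTermAt`
(the generator is an element of the characteristic ideal). Bookkeeping. [cite: Delbourgo1998, Main Conjecture (p. 151)] -/
theorem cycLeadingTermAt_of_cycChar [Fact p.Prime] (h : CycCharLeadingTermAt W p) :
    CycLeadingTermAt W p := by
  intro κ γ hκ hγ hγ' D
  haveI : (Module.charIdeal (IwasawaAlgebra p) D.X).IsPrincipal := charIdeal_isPrincipal_holds p D.X
  obtain ⟨f, hf⟩ := Submodule.IsPrincipal.principal (Module.charIdeal (IwasawaAlgebra p) D.X)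
  obtain ⟨u, q, hLq, hf0⟩ := h κ γ hκ hγ hγ' D f hf
  refine ⟨f, ?_, u, q, hLq, hf0⟩
  change f ∈ Module.charIdeal (IwasawaAlgebra p) D.X
  rw [hf]
  exact Ideal.mem_span_singleton_self f

omit hp in
/-- MC equality at `T = 0` gives the LOWER divisibility (cofactor = the unit). Bookkeeping.
[cite: Delbourgo1998, Main Conjecture (p. 151)] -/
theorem cycLowerLeadingTermAt_of_cycChar [Fact p.Prime] (h : CycCharLeadingTermAt W p) :
    CycLowerLeadingTermAt W p := by
  intro κ γ hκ hγ hγ' D f hf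
  obtain ⟨u, q, hLq, hf0⟩ := h κ γ hκ hγ hγ' D f hf
  exact ⟨q, hLq, (u : ℤ_[p]), hf0⟩

/-! ### Arithmetic bookkeeping shared by the rank-`0` and rank-`1` cores -/

omit hp in
/-- **Valuation bookkeeping, with a cofactor on each side.** From an identity
`c · q · T² = u · ℓ · d · (S · M)` in `ℚ_p` with `u ∈ ℤ_p^×`, `c, d ∈ ℤ_p`, `d ≠ 0`, `q ∈ ℚ^×` and
positive naturals `T, S, M, ℓ`: `c ≠ 0` and `ord_p (q T² / M) + ord_p c = ord_p S + ord_p ℓ + ord_p d`.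
(Used with `T = #E(ℚ)_{tors}`, `S = #Ш[p^∞]`, `M = ∏ c_v`.) [folklore] -/
theorem padicVal_bookkeeping_cofactor [Fact p.Prime] {c d : ℤ_[p]} {q : ℚ} {T S M ℓ : ℕ} (u : ℤ_[p]ˣ)
    (hq : q ≠ 0) (hT : T ≠ 0) (hS : S ≠ 0) (hM : M ≠ 0) (hℓ : ℓ ≠ 0) (hd : d ≠ 0)
    (hkey : (c : ℚ_[p]) * (q : ℚ_[p]) * ((T : ℕ) : ℚ_[p]) ^ 2 =
      ((u : ℤ_[p]) : ℚ_[p]) * (ℓ : ℚ_[p]) * (d : ℚ_[p]) * ((S : ℚ_[p]) * (M : ℚ_[p]))) :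
    c ≠ 0 ∧ padicValRat p (q * (T : ℚ) ^ 2 / (M : ℚ)) + ((c : ℤ_[p]) : ℚ_[p]).valuation =
      padicValNat p S + padicValNat p ℓ + ((d : ℤ_[p]) : ℚ_[p]).valuation := by
  have hqQ : ((q : ℚ) : ℚ_[p]) ≠ 0 := by exact_mod_cast hq
  have hTQ : ((T : ℕ) : ℚ_[p]) ≠ 0 := by exact_mod_cast hT
  have hℓQ : ((ℓ : ℕ) : ℚ_[p]) ≠ 0 := by exact_mod_cast hℓ
  have hSQ : ((S : ℕ) : ℚ_[p]) ≠ 0 := by exact_mod_cast hS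
  have hMQ : ((M : ℕ) : ℚ_[p]) ≠ 0 := by exact_mod_cast hM
  have hdQ : ((d : ℤ_[p]) : ℚ_[p]) ≠ 0 := PadicInt.coe_ne_zero.mpr hd
  have hrhs0 : ((u : ℤ_[p]) : ℚ_[p]) * (ℓ : ℚ_[p]) * (d : ℚ_[p]) * ((S : ℚ_[p]) * (M : ℚ_[p])) ≠ 0 :=
    mul_ne_zero (mul_ne_zero (mul_ne_zero (coe_units_ne_zero p u) hℓQ) hdQ) (mul_ne_zero hSQ hMQ)
  have hc0 : ((c : ℤ_[p]) : ℚ_[p]) ≠ 0 := by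
    intro h0
    rw [h0, zero_mul, zero_mul] at hkey
    exact hrhs0 hkey.symm
  have hc0' : c ≠ 0 := fun h ↦ hc0 (by rw [h]; rfl)
  have hval := congrArg Padic.valuation hkey
  rw [Padic.valuation_mul (mul_ne_zero hc0 hqQ) (pow_ne_zero 2 hTQ), Padic.valuation_mul hc0 hqQ,
    Padic.valuation_pow, Padic.valuation_natCast, Padic.valuation_ratCast,
    Padic.valuation_mul (mul_ne_zero (mul_ne_zero (coe_units_ne_zero p u) hℓQ) hdQ)
      (mul_ne_zero hSQ hMQ),
    Padic.valuation_mul (mul_ne_zero (coe_units_ne_zero p u) hℓQ) hdQ,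
    Padic.valuation_mul (coe_units_ne_zero p u) hℓQ, valuation_coe_units_eq_zero,
    Padic.valuation_natCast, Padic.valuation_mul hSQ hMQ, Padic.valuation_natCast,
    Padic.valuation_natCast] at hval
  refine ⟨hc0', ?_⟩
  have hTq : (T : ℚ) ≠ 0 := by exact_mod_cast hT
  have hMq : (M : ℚ) ≠ 0 := by exact_mod_cast hM
  rw [padicValRat.div (mul_ne_zero hq (pow_ne_zero 2 hTq)) hMq,
    padicValRat.mul hq (pow_ne_zero 2 hTq), padicValRat.pow, padicValRat.of_nat, padicValRat.of_nat]
  simp only [Nat.cast_ofNat] at hval ⊢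
  linarith

omit hp in
/-- **Valuation bookkeeping.** From `c · q · T² = u · ℓ · (S · M)` in `ℚ_p` (`u ∈ ℤ_p^×`, `c ∈ ℤ_p`,
`q ∈ ℚ^×`, `T, S, M, ℓ` positive naturals): `c ≠ 0` and `ord_p (q T² / M) + ord_p c = ord_p S + ord_p ℓ`.
[folklore] -/
theorem padicVal_bookkeeping [Fact p.Prime] {c : ℤ_[p]} {q : ℚ} {T S M ℓ : ℕ} (u : ℤ_[p]ˣ)
    (hq : q ≠ 0) (hT : T ≠ 0) (hS : S ≠ 0) (hM : M ≠ 0) (hℓ : ℓ ≠ 0)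
    (hkey : (c : ℚ_[p]) * (q : ℚ_[p]) * ((T : ℕ) : ℚ_[p]) ^ 2 =
      ((u : ℤ_[p]) : ℚ_[p]) * (ℓ : ℚ_[p]) * ((S : ℚ_[p]) * (M : ℚ_[p]))) :
    c ≠ 0 ∧ padicValRat p (q * (T : ℚ) ^ 2 / (M : ℚ)) + ((c : ℤ_[p]) : ℚ_[p]).valuation =
      padicValNat p S + padicValNat p ℓ := by
  have hkey' : (c : ℚ_[p]) * (q : ℚ_[p]) * ((T : ℕ) : ℚ_[p]) ^ 2 =
      ((u : ℤ_[p]) : ℚ_[p]) * (ℓ : ℚ_[p]) * (((1 : ℤ_[p]) : ℤ_[p]) : ℚ_[p]) *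
        ((S : ℚ_[p]) * (M : ℚ_[p])) := by
    rw [hkey]; push_cast; ring
  obtain ⟨hc, hv⟩ := padicVal_bookkeeping_cofactor (p := p) u hq hT hS hM hℓ one_ne_zero hkey'
  refine ⟨hc, ?_⟩
  have h1 : (((1 : ℤ_[p]) : ℤ_[p]) : ℚ_[p]).valuation = 0 := by push_cast; exact Padic.valuation_one
  rw [h1, add_zero] at hv
  exact hv

/-! ### §1 The core: a constant-term identity + Delbourgo 2002 ⟹ `ord_p #Ш_an + ord_p c = ord_p #Ш + ord_p ℓ` -/

variable (W p) [W.IsElliptic] [W.IsGloballyMinimal]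

/-- **Core, data level (rank `0`, the (G)-cell, `p ≥ 5`).** Let `E = W` be globally minimal, non-CM,
ADDITIVE and (G)-ORDINARY at `p ≥ 5` (`TypeGOrd W p`: potentially good ordinary), `ord_{s=1} L(E,s) = 0`;
`κ, γ` the cyclotomic `ℤ_p`-extension and a topological generator matching the cyclotomic variable,
`D` a dual datum of `Sel_{p^∞}(E/ℚ_∞)`, `f` a generator of `char_Λ X`, and suppose
`f(0) = c · q` with `L(E,1) = q · Ω_E`, `c ∈ ℤ_p`. Then by Delbourgo 2002 (A)+(B) in rank `0`
(named fact `hDel`: `f(0) · #E(ℚ)_{tors}² ∼ ℓ · #Ш(p) · ∏ c_v`, `ℓ ∣ p²`, `ℓ = 1` off the anomalous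
rows; the height datum is immaterial in rank `0`), Gross–Zagier–Kolyvagin and modularity:
`#Ш_an(E) = q' ∈ ℚ`, `q' ≠ 0`, `c ≠ 0`, and **`ord_p q' + ord_p c = ord_p #Ш(E) + ord_p ℓ`**.
[cite: Delbourgo2002, Theorem (A), (B) (p. 40)] -/
theorem exists_padicVal_shaAn_of_constantCoeff_eq (hDel : Delbourgo2002.mainTheorem)
    (hGZK : rank_eq_analyticRank_of_analyticRank_le_one) (hmod : hasEntireLFunction_rat)
    (hp5 : 5 ≤ p) (hcm : ¬ W.HasCM) (hadd : Addv W p) (hG : TypeGOrd W p)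
    (hr : W.analyticRank = 0)
    {κ : ZpExtension ℚ p} {γ : Field.absoluteGaloisGroup ℚ}
    (hκ : κ.IsCyclotomic) (hγ : κ.IsTopGenerator γ) (hγ' : IsCyclotomicVariable p γ)
    (D : W.SelmerDualData κ γ) {f : IwasawaAlgebra p} (hf : D.charIdeal = Ideal.span {f})
    {q : ℚ} (hLq : W.entireLFunction 1 = (q : ℂ) * (W.realPeriodRat : ℂ))
    {c : ℤ_[p]} (hf0 : ((PowerSeries.constantCoeff f : ℤ_[p]) : ℚ_[p]) = (c : ℚ_[p]) * (q : ℚ_[p])) :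
    ∃ q' : ℚ, shaAn W = (q' : ℂ) ∧ q' ≠ 0 ∧ c ≠ 0 ∧
      ∃ ℓ : ℕ, ℓ ∣ p ^ 2 ∧ (Delbourgo2002.ReductionNonAnomalous W p → ℓ = 1) ∧
        padicValRat p q' + ((c : ℤ_[p]) : ℚ_[p]).valuation =
          padicValNat p W.shaOrder + padicValNat p ℓ := by
  classical
  have hpP : p.Prime := hp.out
  -- rank 0: `L(E,1) ≠ 0`, `E(ℚ)` and `Ш` finite
  have hL : W.entireLFunction 1 ≠ 0 := (W.analyticRank_eq_zero_iff_holds (hmod W)).mp hr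
  obtain ⟨hmw, hfin⟩ := hGZK W (by rw [hr]; exact zero_le_one)
  have hmw0 : W.mordellWeilRank = 0 := by rw [hmw, hr]
  haveI : Finite W.sha := hfin
  haveI hE : Finite W.toAffine.Point := W.finite_point_of_rank_zero hmw0
  have hfinp : Finite (AddCommGroup.primaryComponent W.sha p) :=
    Finite.of_injective _ Subtype.val_injective
  haveI : Module.Finite (IwasawaAlgebra p) D.X :=
    SelmerDualData.module_finite_of_isCyclotomic (W := W) (κ := κ) hκ D hγ
  -- Delbourgo 2002 (A): torsion; (B) in rank 0: the constant term
  have hadd' : ¬ W.HasGoodReductionAtPrime p ∧ ¬ W.HasMultiplicativeReductionAtPrime p := hadd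
  have hX : D.IsTorsion := Delbourgo2002.mainTheorem.isTorsion hDel hp5 hcm hadd' hG hκ hγ D
  obtain ⟨Dh, hB⟩ := Delbourgo2002.mainTheorem.exists_leadingTermClauses hDel hp5 hcm hadd' hG
  obtain ⟨-, u, ℓ, hℓp, hℓ1, heq⟩ := hB.constantCoeff hκ hγ hγ' D hX hf hfinp
  -- `#Ш_an = q · #E(ℚ)² / ∏ c_v`
  have hΩ : (W.realPeriodRat : ℂ) ≠ 0 := by exact_mod_cast W.realPeriodRat_pos_holds.ne'
  have hq' : W.entireLFunction 1 / (W.realPeriodRat : ℂ) = (q : ℂ) := by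
    rw [hLq, mul_div_cancel_right₀ _ hΩ]
  obtain ⟨-, -, -, hshaAn⟩ := Wuthrich2014.shaAn_eq_of_L_one_div_eq hGZK W hL hq'
  have hq0 : q ≠ 0 := by
    intro h0
    apply hL
    rw [hLq, h0, Rat.cast_zero, zero_mul]
  -- the arithmetic quantities and their non-vanishing
  set T : ℕ := Nat.card W.toAffine.Point with hT
  have hTtors : W.torsionOrder = T := (W.natCard_point_eq_torsionOrder).symm
  have hT0 : T ≠ 0 := by rw [hT]; exact Nat.card_pos.ne'
  have hTam : 0 < W.tamagawaProduct := W.tamagawaProduct_pos_holds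
  have hS0 : Nat.card (AddCommGroup.primaryComponent W.sha p) ≠ 0 := Nat.card_pos.ne'
  have hℓ0 : ℓ ≠ 0 := by
    rintro rfl
    exact pow_ne_zero 2 hpP.ne_zero (Nat.eq_zero_of_zero_dvd hℓp)
  have hsha : padicValNat p (Nat.card (AddCommGroup.primaryComponent W.sha p)) =
      padicValNat p W.shaOrder := by
    unfold WeierstrassCurve.shaOrder
    exact padicValNat_card_addPrimaryComponent p
  -- the identity `c q T² = u ℓ #Ш(p) Tam` in `ℚ_p` and its valuation
  have hkey : (c : ℚ_[p]) * (q : ℚ_[p]) * ((T : ℕ) : ℚ_[p]) ^ 2 =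
      ((u : ℤ_[p]) : ℚ_[p]) * (ℓ : ℚ_[p]) *
        ((Nat.card (AddCommGroup.primaryComponent W.sha p) : ℚ_[p]) * (W.tamagawaProduct : ℚ_[p])) := by
    rw [← hf0, ← heq, hTtors]
  obtain ⟨hc0, hval⟩ := padicVal_bookkeeping (p := p) u hq0 hT0 hS0 hTam.ne' hℓ0 hkey
  rw [hsha] at hval
  have hTq : (T : ℚ) ≠ 0 := by exact_mod_cast hT0
  have hPq : (W.tamagawaProduct : ℚ) ≠ 0 := by exact_mod_cast hTam.ne'
  exact ⟨q * (T : ℚ) ^ 2 / (W.tamagawaProduct : ℚ), by rw [hshaAn],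
    div_ne_zero (mul_ne_zero hq0 (pow_ne_zero 2 hTq)) hPq, hc0, ℓ, hℓp, hℓ1, hval⟩

omit [W.IsElliptic] [W.IsGloballyMinimal] in
/-- The cyclotomic setting exists and `char_Λ X` is principal: a dual datum `D` of `Sel_{p^∞}(E/ℚ_∞)`
for the cyclotomic `ℤ_p`-extension with a topological generator matching the cyclotomic variable,
and a generator of its characteristic ideal (tree theorems
`exists_isCyclotomic_isTopGenerator_isCyclotomicVariable_holds`, `nonempty_selmerDualData_holds`,
`charIdeal_isPrincipal_holds`). Bookkeeping. [cite: GreenbergLNM1716, §1 (the cyclotomic Iwasawa module)] -/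
theorem exists_cyclotomic_dualData_generator :
    ∃ (κ : ZpExtension ℚ p) (γ : Field.absoluteGaloisGroup ℚ), κ.IsCyclotomic ∧ κ.IsTopGenerator γ ∧
      IsCyclotomicVariable p γ ∧ ∃ (D : W.SelmerDualData κ γ) (f : IwasawaAlgebra p),
        D.charIdeal = Ideal.span {f} := by
  obtain ⟨κ, hκ, γ, hγ, hγ'⟩ := exists_isCyclotomic_isTopGenerator_isCyclotomicVariable_holds p
  obtain ⟨D⟩ := W.nonempty_selmerDualData_holds κ γ hγ
  haveI : (Module.charIdeal (IwasawaAlgebra p) D.X).IsPrincipal := charIdeal_isPrincipal_holds p D.X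
  obtain ⟨f, hf⟩ := Submodule.IsPrincipal.principal (Module.charIdeal (IwasawaAlgebra p) D.X)
  exact ⟨κ, γ, hκ, hγ, hγ', D, f, hf⟩

/-- **Core from the typed LOWER divisibility.** On the (G)-cell (rank `0`, `p ≥ 5`, non-CM):
`CycLowerLeadingTermAt W p` + Delbourgo 2002 ⟹ `#Ш_an = q`, `ord_p q + ord_p c = ord_p #Ш + ord_p ℓ`
with `c ∈ ℤ_p ∖ {0}` the cofactor and `ℓ ∣ p²`, `ℓ = 1` off the anomalous rows.
[cite: Delbourgo2002, Theorem (A), (B) (p. 40)] -/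
theorem exists_padicVal_shaAn_of_cycLowerLeadingTerm (hDel : Delbourgo2002.mainTheorem)
    (hGZK : rank_eq_analyticRank_of_analyticRank_le_one) (hmod : hasEntireLFunction_rat)
    (hp5 : 5 ≤ p) (hcm : ¬ W.HasCM) (hadd : Addv W p) (hG : TypeGOrd W p)
    (hr : W.analyticRank = 0) (hLow : CycLowerLeadingTermAt W p) :
    ∃ q : ℚ, shaAn W = (q : ℂ) ∧ q ≠ 0 ∧
      ∃ (c : ℤ_[p]) (ℓ : ℕ), c ≠ 0 ∧ ℓ ∣ p ^ 2 ∧ (Delbourgo2002.ReductionNonAnomalous W p → ℓ = 1) ∧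
        padicValRat p q + ((c : ℤ_[p]) : ℚ_[p]).valuation = padicValNat p W.shaOrder + padicValNat p ℓ := by
  obtain ⟨κ, γ, hκ, hγ, hγ', D, f, hf⟩ := exists_cyclotomic_dualData_generator W p
  obtain ⟨q, hLq, c, hf0⟩ := hLow κ γ hκ hγ hγ' D f hf
  obtain ⟨q', hq', hq'0, hc0, ℓ, hℓp, hℓ1, hval⟩ :=
    exists_padicVal_shaAn_of_constantCoeff_eq W p hDel hGZK hmod hp5 hcm hadd hG hr hκ hγ hγ' D hf
      hLq hf0
  exact ⟨q', hq', hq'0, c, ℓ, hc0, hℓp, hℓ1, hval⟩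

/-- **Core from the typed MC EQUALITY.** On the (G)-cell (rank `0`, `p ≥ 5`, non-CM):
`CycCharLeadingTermAt W p` + Delbourgo 2002 ⟹ `#Ш_an = q` with **`ord_p q = ord_p #Ш + ord_p ℓ`**,
`ℓ ∣ p²`, `ℓ = 1` off the anomalous rows (the cofactor is a unit).
[cite: Delbourgo2002, Theorem (A), (B) (p. 40)] -/
theorem exists_padicVal_shaAn_of_cycCharLeadingTerm (hDel : Delbourgo2002.mainTheorem)
    (hGZK : rank_eq_analyticRank_of_analyticRank_le_one) (hmod : hasEntireLFunction_rat)
    (hp5 : 5 ≤ p) (hcm : ¬ W.HasCM) (hadd : Addv W p) (hG : TypeGOrd W p)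
    (hr : W.analyticRank = 0) (hMC : CycCharLeadingTermAt W p) :
    ∃ q : ℚ, shaAn W = (q : ℂ) ∧ q ≠ 0 ∧
      ∃ ℓ : ℕ, ℓ ∣ p ^ 2 ∧ (Delbourgo2002.ReductionNonAnomalous W p → ℓ = 1) ∧
        padicValRat p q = padicValNat p W.shaOrder + padicValNat p ℓ := by
  obtain ⟨κ, γ, hκ, hγ, hγ', D, f, hf⟩ := exists_cyclotomic_dualData_generator W p
  obtain ⟨u, q, hLq, hf0⟩ := hMC κ γ hκ hγ hγ' D f hf
  obtain ⟨q', hq', hq'0, -, ℓ, hℓp, hℓ1, hval⟩ :=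
    exists_padicVal_shaAn_of_constantCoeff_eq W p hDel hGZK hmod hp5 hcm hadd hG hr hκ hγ hγ' D hf
      hLq (c := (u : ℤ_[p])) hf0
  refine ⟨q', hq', hq'0, ℓ, hℓp, hℓ1, ?_⟩
  rw [valuation_coe_units_eq_zero, add_zero] at hval
  exact hval

end Summit.BirchSwinnertonDyer.Rank1Residual.Additive

end
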